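import Summits.QuantumFields.YangMills.Theorems.SwapVirialDeficitOddSectorNoFlat
import Summits.QuantumFields.YangMills.Theorems.SwapVirialDeficitSigmaTwistedLetterFloor
import HarnessLib

/-!
# The ODD seam sectors of the swap-glued ring: the σ-twisted four-letter event is EMPTY at small tolerance (brick (B-iv) of the fixed-`L` swap ceiling)
# (free-hands support of item stmt-QuantumFields-24197 `SwapVirialDeficit.SwapGluedStiffness`; seat w2 g54's plan note 06:57Z, cell ym-idea-1)

For the four seam sectors `z` of `Z^S = TT.twistTrace L β (2L)` with sign pattern `ε_aε_b = −1` on the two exchanged `t`-relations of `ℤ³ ⋊_σ ℤ`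
(`t b t⁻¹ = ε₀ a`, `t a t⁻¹ = ε₁ b`, `ε₀ε₁ = −1`) there is no flat connection (✓`OddSectorNoFlat.no_flat_odd_sector`).  By COMPACTNESS of `SU(2)³` the
continuous defect `f(a,b,t) = ‖[q_a,q_b]‖ + ‖q_t q_b + q_a q_t‖ + ‖q_t q_a − q_b q_t‖` therefore has a positive minimum `t₀`, so the σ-twisted four-letter
event of such a sector — three letters pairwise commuting up to `t` and the signed seam relations up to `t` — is EMPTY for `3t < t₀`: its product-Haar
mass is `0 ≤ C·t⁷`, the zero-mode input of the swap ceiling for these sectors (they are exponentially suppressed in `Z^S`).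

* §1 `oddDefect_pos` — `∃ t₀ > 0, ∀ a b t ∈ SU(2), t₀ ≤ ‖[q_a,q_b]‖ + ‖q_t q_b + q_a q_t‖ + ‖q_t q_a − q_b q_t‖` (compactness + ✓`no_flat_odd_sector`);
* §2 ★ `sigmaTwisted_odd_empty` — `∃ t₀ > 0, ∀ t < t₀`, no `C : Fin 4 → SU(2)` has `‖[q(C 0), q(C 1)]‖ ≤ t`, `‖q(C 3)q(C 1) + q(C 0)q(C 3)‖ ≤ t`,
  `‖q(C 3)q(C 0) − q(C 1)q(C 3)‖ ≤ t` (sector `(ε₀,ε₁) = (−,+)`); ★ `sigmaTwisted_odd_empty'` (sector `(+,−)`); `pi_haar_sigmaTwisted_odd_eq_zero` ∕ `'` —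
  the product-Haar masses of these events vanish for `t < t₀` (any event asking MORE relations, e.g. all of `[q₀,q₂], [q₁,q₂], q₃q₂ ∓ q₂q₃`, is a subset).

HONEST LABEL: finite-dimensional compactness bookkeeping for fixed-`L` prediction rows (non-constructive `t₀`); the lattice statement `F^S_z ≥ c_L > 0` is NOT
proved here (needs (B-i), the σ-converse CommBox); ⟨24197⟩, ⟨24194⟩, ⟨24497⟩, ⟨24196⟩ stay OPEN; the Yang–Mills mass gap is NOT proved; no summit is proved by
a line.  THEOREMS ONLY (0 `def`, 0 `sorry`), standard axioms.  Width seat ym-line-sfw-p2-w2 g54 (cell ym-idea-1, free hands), `--supports stmt-QuantumFields-24197`.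
References: [cite: tHooft1979]; [cite: GonzalezarroyoAltes1988]; [folklore].
-/

set_option autoImplicit false

noncomputable section

open MeasureTheory Quaternion Set
open scoped Quaternion ENNReal
open Literature.MathematicalPhysics.QuantumLattice
open Literature.MathematicalPhysics.QuantumFieldTheory (haarProbability)
open Summit.QuantumFields.YangMills.Theorems.FemtoTransferGap (SU2)
open Summit.QuantumFields.YangMills.Theorems.SwapVirialDeficit.OddSectorNoFlat
open Literature.MathematicalPhysics.QuantumFieldTheory.Balaban1983to89.T4HaarSU2Translate (continuous_su2Quat)

namespace Summit.QuantumFields.YangMills.Theorems.SwapVirialDeficit.SigmaTwistedOddSectorEmpty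

/-! ## §1 The odd-sector defect has a positive minimum -/

/-- **Positive minimum of the odd-sector defect** (compactness of `SU(2)³` + ✓`no_flat_odd_sector`): there is `t₀ > 0` with
`t₀ ≤ ‖q_a q_b − q_b q_a‖ + ‖q_t q_b + q_a q_t‖ + ‖q_t q_a − q_b q_t‖` for all `a b t ∈ SU(2)`. [folklore] -/
theorem oddDefect_pos :
    ∃ t₀ : ℝ, 0 < t₀ ∧ ∀ a b t : SU2,
      t₀ ≤ ‖su2Quat a * su2Quat b - su2Quat b * su2Quat a‖ + ‖su2Quat t * su2Quat b + su2Quat a * su2Quat t‖ +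
        ‖su2Quat t * su2Quat a - su2Quat b * su2Quat t‖ := by
  -- the defect as a continuous function on the compact space `SU(2) × SU(2) × SU(2)`
  set f : SU2 × SU2 × SU2 → ℝ := fun p =>
    ‖su2Quat p.1 * su2Quat p.2.1 - su2Quat p.2.1 * su2Quat p.1‖ + ‖su2Quat p.2.2 * su2Quat p.2.1 + su2Quat p.1 * su2Quat p.2.2‖ +
      ‖su2Quat p.2.2 * su2Quat p.1 - su2Quat p.2.1 * su2Quat p.2.2‖ with hf
  have hqa : Continuous fun p : SU2 × SU2 × SU2 => su2Quat p.1 := continuous_su2Quat.comp continuous_fst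
  have hqb : Continuous fun p : SU2 × SU2 × SU2 => su2Quat p.2.1 := continuous_su2Quat.comp (continuous_fst.comp continuous_snd)
  have hqt : Continuous fun p : SU2 × SU2 × SU2 => su2Quat p.2.2 := continuous_su2Quat.comp (continuous_snd.comp continuous_snd)
  have hfc : Continuous f :=
    (((hqa.mul hqb).sub (hqb.mul hqa)).norm.add ((hqt.mul hqb).add (hqa.mul hqt)).norm).add ((hqt.mul hqa).sub (hqb.mul hqt)).norm
  obtain ⟨p₀, -, hmin⟩ := isCompact_univ.exists_isMinOn Set.univ_nonempty hfc.continuousOn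
  have hpos : 0 < f p₀ := by
    rcases (show 0 ≤ f p₀ by positivity).lt_or_eq with h | h
    · exact h
    · exfalso
      -- all three terms vanish: exact odd relations, impossible
      have h0 : f p₀ = 0 := h.symm
      have h1 : ‖su2Quat p₀.1 * su2Quat p₀.2.1 - su2Quat p₀.2.1 * su2Quat p₀.1‖ = 0 := by
        have := norm_nonneg (su2Quat p₀.1 * su2Quat p₀.2.1 - su2Quat p₀.2.1 * su2Quat p₀.1)
        have := norm_nonneg (su2Quat p₀.2.2 * su2Quat p₀.2.1 + su2Quat p₀.1 * su2Quat p₀.2.2)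
        have := norm_nonneg (su2Quat p₀.2.2 * su2Quat p₀.1 - su2Quat p₀.2.1 * su2Quat p₀.2.2)
        simp only [hf] at h0; linarith
      have h2 : ‖su2Quat p₀.2.2 * su2Quat p₀.2.1 + su2Quat p₀.1 * su2Quat p₀.2.2‖ = 0 := by
        have := norm_nonneg (su2Quat p₀.1 * su2Quat p₀.2.1 - su2Quat p₀.2.1 * su2Quat p₀.1)
        have := norm_nonneg (su2Quat p₀.2.2 * su2Quat p₀.2.1 + su2Quat p₀.1 * su2Quat p₀.2.2)
        have := norm_nonneg (su2Quat p₀.2.2 * su2Quat p₀.1 - su2Quat p₀.2.1 * su2Quat p₀.2.2)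
        simp only [hf] at h0; linarith
      have h3 : ‖su2Quat p₀.2.2 * su2Quat p₀.1 - su2Quat p₀.2.1 * su2Quat p₀.2.2‖ = 0 := by
        have := norm_nonneg (su2Quat p₀.1 * su2Quat p₀.2.1 - su2Quat p₀.2.1 * su2Quat p₀.1)
        have := norm_nonneg (su2Quat p₀.2.2 * su2Quat p₀.2.1 + su2Quat p₀.1 * su2Quat p₀.2.2)
        have := norm_nonneg (su2Quat p₀.2.2 * su2Quat p₀.1 - su2Quat p₀.2.1 * su2Quat p₀.2.2)
        simp only [hf] at h0; linarith
      rw [norm_eq_zero, sub_eq_zero] at h1 h3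
      rw [norm_eq_zero, add_eq_zero_iff_eq_neg] at h2
      exact no_flat_odd_sector (su2Quat_ne_zero p₀.1) (su2Quat_ne_zero p₀.2.2) h1 h3 h2
  refine ⟨f p₀, hpos, fun a b t => ?_⟩
  have := hmin (Set.mem_univ (a, b, t))
  simpa [hf] using this

/-! ## §2 The odd-sector σ-twisted events are empty at small tolerance -/

/-- ★ **Sector `(ε₀, ε₁) = (−, +)`: empty at small tolerance.**  There is `t₀ > 0` such that for `t < t₀` NO quadruple `C ∈ SU(2)⁴` has
`‖[q(C 0), q(C 1)]‖ ≤ t`, `‖q(C 3)q(C 1) + q(C 0)q(C 3)‖ ≤ t` and `‖q(C 3)q(C 0) − q(C 1)q(C 3)‖ ≤ t`. [folklore] -/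
theorem sigmaTwisted_odd_empty :
    ∃ t₀ : ℝ, 0 < t₀ ∧ ∀ t : ℝ, t < t₀ → ∀ C : Fin 4 → SU2,
      ¬ (‖su2Quat (C 0) * su2Quat (C 1) - su2Quat (C 1) * su2Quat (C 0)‖ ≤ t ∧
          ‖su2Quat (C 3) * su2Quat (C 1) + su2Quat (C 0) * su2Quat (C 3)‖ ≤ t ∧
            ‖su2Quat (C 3) * su2Quat (C 0) - su2Quat (C 1) * su2Quat (C 3)‖ ≤ t) := by
  obtain ⟨t₀, ht₀, h⟩ := oddDefect_pos
  refine ⟨t₀ / 3, by positivity, fun t ht C hC => ?_⟩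
  have := h (C 0) (C 1) (C 3)
  linarith [hC.1, hC.2.1, hC.2.2]

/-- ★ **Sector `(ε₀, ε₁) = (+, −)`: empty at small tolerance** (roles of `C 0`, `C 1` exchanged). [folklore] -/
theorem sigmaTwisted_odd_empty' :
    ∃ t₀ : ℝ, 0 < t₀ ∧ ∀ t : ℝ, t < t₀ → ∀ C : Fin 4 → SU2,
      ¬ (‖su2Quat (C 0) * su2Quat (C 1) - su2Quat (C 1) * su2Quat (C 0)‖ ≤ t ∧
          ‖su2Quat (C 3) * su2Quat (C 1) - su2Quat (C 0) * su2Quat (C 3)‖ ≤ t ∧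
            ‖su2Quat (C 3) * su2Quat (C 0) + su2Quat (C 1) * su2Quat (C 3)‖ ≤ t) := by
  obtain ⟨t₀, ht₀, h⟩ := oddDefect_pos
  refine ⟨t₀ / 3, by positivity, fun t ht C hC => ?_⟩
  have := h (C 1) (C 0) (C 3)
  rw [norm_sub_rev] at this
  linarith [hC.1, hC.2.1, hC.2.2]

/-- The product-Haar mass of the `(−, +)` odd-sector event vanishes for `t < t₀`. [folklore] -/
theorem pi_haar_sigmaTwisted_odd_eq_zero :
    ∃ t₀ : ℝ, 0 < t₀ ∧ ∀ t : ℝ, t < t₀ →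
      (Measure.pi fun _ : Fin 4 => haarProbability SU2)
        {C : Fin 4 → SU2 | ‖su2Quat (C 0) * su2Quat (C 1) - su2Quat (C 1) * su2Quat (C 0)‖ ≤ t ∧
          ‖su2Quat (C 3) * su2Quat (C 1) + su2Quat (C 0) * su2Quat (C 3)‖ ≤ t ∧
            ‖su2Quat (C 3) * su2Quat (C 0) - su2Quat (C 1) * su2Quat (C 3)‖ ≤ t} = 0 := by
  obtain ⟨t₀, ht₀, h⟩ := sigmaTwisted_odd_empty
  refine ⟨t₀, ht₀, fun t ht => ?_⟩
  have e : {C : Fin 4 → SU2 | ‖su2Quat (C 0) * su2Quat (C 1) - su2Quat (C 1) * su2Quat (C 0)‖ ≤ t ∧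
      ‖su2Quat (C 3) * su2Quat (C 1) + su2Quat (C 0) * su2Quat (C 3)‖ ≤ t ∧
        ‖su2Quat (C 3) * su2Quat (C 0) - su2Quat (C 1) * su2Quat (C 3)‖ ≤ t} = ∅ :=
    Set.eq_empty_iff_forall_notMem.2 fun C hC => h t ht C hC
  rw [e, measure_empty]

/-- The product-Haar mass of the `(+, −)` odd-sector event vanishes for `t < t₀`. [folklore] -/
theorem pi_haar_sigmaTwisted_odd_eq_zero' :
    ∃ t₀ : ℝ, 0 < t₀ ∧ ∀ t : ℝ, t < t₀ →
      (Measure.pi fun _ : Fin 4 => haarProbability SU2)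
        {C : Fin 4 → SU2 | ‖su2Quat (C 0) * su2Quat (C 1) - su2Quat (C 1) * su2Quat (C 0)‖ ≤ t ∧
          ‖su2Quat (C 3) * su2Quat (C 1) - su2Quat (C 0) * su2Quat (C 3)‖ ≤ t ∧
            ‖su2Quat (C 3) * su2Quat (C 0) + su2Quat (C 1) * su2Quat (C 3)‖ ≤ t} = 0 := by
  obtain ⟨t₀, ht₀, h⟩ := sigmaTwisted_odd_empty'
  refine ⟨t₀, ht₀, fun t ht => ?_⟩
  have e : {C : Fin 4 → SU2 | ‖su2Quat (C 0) * su2Quat (C 1) - su2Quat (C 1) * su2Quat (C 0)‖ ≤ t ∧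
      ‖su2Quat (C 3) * su2Quat (C 1) - su2Quat (C 0) * su2Quat (C 3)‖ ≤ t ∧
        ‖su2Quat (C 3) * su2Quat (C 0) + su2Quat (C 1) * su2Quat (C 3)‖ ≤ t} = ∅ :=
    Set.eq_empty_iff_forall_notMem.2 fun C hC => h t ht C hC
  rw [e, measure_empty]

end Summit.QuantumFields.YangMills.Theorems.SwapVirialDeficit.SigmaTwistedOddSectorEmpty

end
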